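import Literature.IUT.LogVolume.Corollary22ThetaClosureData
import Literature.IUT.HodgeTheaters.ThetaGeometryInhabited
import HarnessLib

/-!
# Crux `ThetaPartII` (route `IUTThetaPilot`), layer-2 skeleton `Display` v1.2: the stub `stub_thetaData` CLOSED

[IUTchIV] Cor. 2.2 (ii), proof (P7), kurims p. 46: "there exist data … such that all of the conditions of [IUTchI],
Definition 3.1, (a)–(f), are satisfied". The registered stub of crux `stmt-ABC-19678` (skeleton
`ThetaPartII-Display.lean` v1.2, abc-iut-c312-8; binders EXACTLY those of `Cor22.Thm110Legendre`):

  `stub_thetaData : ∀ P : NFPoint, P ∈ UP → ∀ l : ℕ, l.Prime → 5 ≤ l → Cor22.AdmitsCore P → Cor22.CondP2 P l →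
     Cor22.CondP5 P l → Cor22.CondP6 P l → Cor22.ThetaDataExistsAt P l`

is PROVED here in the cell's reading of record (abc-iut-plan 2026-08-26T02:59:03Z): the genuine Θ-volume datum at
`(P, l)` (`Cor22.ThetaVolumeDatumAt`, v3) is inhabited with `F := F‡(P) = F_tpd(√−1, √λ, √(λ−1), E_λ[15])` (Galois
over `F_mod`), `E_F := E_λ ⊗ F‡` (abc-iut-L5-t7's `Cor22.thetaDataExistsAt_of_condP6_thetaClosure`), the `π₁`-interface
objects of [IUTchI] Def. 3.1 (d)(e)(f) being supplied by the cell's INTERFACE INHABITANTS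
(`ThetaGeometryModel.nonempty_thetaGeometry_galois`, `BadPlacePredicates.trivial`: abc-iut-S2 / w5-d056 — profinite
witnesses of the typed interface, NOT the étale fundamental groups of campaign L; the cell records that the interface as
typed carries no `π₁` content, `ThetaGeometryInhabited.lean`). Classical + interface bookkeeping; TAKES NO SIDE on
[IUTchIII] Cor. 3.12. [claim: Mochizuki2012, status: disputed] for the IUT quotation.
-/

noncomputable section

set_option linter.dupNamespace false

namespace Summit.ABC.ABC.Theorems.ThetaPartII

open Literature.NumberTheory.DiophantineGeometry.GenEll Literature.IUT.LogVolume Literature.IUT.HodgeTheaters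

/-- **`stub_thetaData` of the `Display` skeleton of crux `ThetaPartII`**: for every `λ`-line point `P ∈ U_P` and prime
`l ≥ 5` with `AdmitsCore`, (P2), (P5), (P6), a genuine Θ-volume datum exists at `(P, l)` — initial Θ-data on
`(F‡(P), E_λ ⊗ F‡(P), l)` with `𝕍^bad_mod` the (P5) choice, ideles in the genuine completions, over the interface
inhabitants of [IUTchI] Def. 3.1 (d)(e)(f). [cite: Mochizuki2012, IUTchIV Cor. 2.2 (ii) proof (P7) p. 46] -/
theorem stub_thetaData : ∀ P : NFPoint, P ∈ UP → ∀ l : ℕ, l.Prime → 5 ≤ l → Cor22.AdmitsCore P →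
    Cor22.CondP2 P l → Cor22.CondP5 P l → Cor22.CondP6 P l → Cor22.ThetaDataExistsAt P l := by
  intro P hP l hl h5 hcore hP2 hP5 h6
  haveI : Fact P.InU := ⟨hP.1⟩
  haveI : (Cor22.thetaCurve P (Cor22.thetaClosureField P)).IsElliptic := Cor22.thetaCurve_isElliptic hP.1 _
  haveI : NeZero l := ⟨hl.ne_zero⟩
  haveI : IsGalois (Cor22.thetaClosureField P) (AlgebraicClosure (Cor22.thetaClosureField P)) := {}
  have h7 : 7 ≤ l := Cor22.seven_le_of_condP6 hP.1 hl h5 h6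
  have h6cop : l.Coprime 6 := by
    rw [show (6 : ℕ) = 2 * 3 by norm_num]
    exact Nat.Coprime.mul_right ((Nat.coprime_primes hl Nat.prime_two).2 (by omega))
      ((Nat.coprime_primes hl Nat.prime_three).2 (by omega))
  obtain ⟨geom⟩ := ThetaGeometryModel.nonempty_thetaGeometry_galois (Cor22.thetaClosureField P)
    (TorsionField (Cor22.thetaCurve P (Cor22.thetaClosureField P)) l) (AlgebraicClosure (Cor22.thetaClosureField P))
    h5 h6cop
  exact Cor22.thetaDataExistsAt_of_condP6_thetaClosure P hP hl h5 hcore hP2 hP5 h6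
    (BadPlacePredicates.trivial _) geom
    (fun w _ => (BadPlacePredicates.trivial_holds _ w).1) (fun w _ => (BadPlacePredicates.trivial_holds _ w).2)

end Summit.ABC.ABC.Theorems.ThetaPartII

end
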